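import Summits.ResolutionOfSingularities.ResolutionOfSingularities.Theorems.SharpStrataResSepExcDimension
import Summits.ResolutionOfSingularities.ResolutionOfSingularities.Theorems.SharpStrataSepExcModelsDefs
import HarnessLib

/-!
# Crux `SharpStrata.SepExcModels` (stmt-16828): dimension calibration — the crux starts in dimension 4,
# the canonical Kolchin phase starts in dimension 3

Line `birth`, lead c1, cycle 2, tool stub T9 `stub_sepExcModels_iff_dimGe4`. Every theorem PROVED, no
definition; the only hypothesis ever taken is the tree's named fact `CossartPiltant2019` (resolution
of reduced separated finite-type schemes of dimension `≤ 3` over every field,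
`Literature/AlgebraicGeometry/Resolution/ResolutionOfSingularities.lean`).

* `sepExcModels_dimLE_three` — **the crux in dimension `≤ 3`**, modulo `CossartPiltant2019`: a
  resolution `X' → X` is a separably exceptional model (every point of the regular `X'` satisfies the
  first disjunct of `SepExc`). Perfectness of `k` idle.
* `stub_sepExcModels_iff_dimGe4` — hence **the crux `SepExcModels` is its dimension-`≥ 4` slice**
  modulo `CossartPiltant2019`: a proof must begin with fourfolds, a refutation must exhibit a variety
  of dimension `≥ 4` over a perfect field without separably exceptional proper birational model
  (which refutes the summit itself, by `Lossless`).
* `sepExcModels_dimLE_four_of_finiteSingularModelsDimFour` — the dimension-`≤ 4` slice from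
  stmt-18022 (`IsolatedCore.FiniteSingularModelsDimFour`: isolated-singularity models of fourfolds,
  the "known floor" item of route IsolatedCore): its model is regular or closed at every point.

CONTRAST with the line (for crux-plan): the canonical Kolchin phase of `Lines/birth.lean` already has
open content in dimension 3 (`Cruxes/SepExcModels/bluntness-certificates.md` §3: (Q) + horizontal +
vertical), because it insists on ONE specific process; the crux itself, in dimension 3, is settled by
any resolution. So a dimension-3 failure of `stub_kolchinTerminates` would kill the line, not the crux.
-/

noncomputable section

-- single-problem summit: the doubled namespace component `ResolutionOfSingularities` is forced
set_option linter.dupNamespace false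

open CategoryTheory AlgebraicGeometry Literature.AlgebraicGeometry.Resolution
open Summit.ResolutionOfSingularities.ResolutionOfSingularities.Theses

namespace Summit.ResolutionOfSingularities.ResolutionOfSingularities.Theorems.SepExcModels.Dimension

/-- **The crux in dimension `≤ 3`, modulo `CossartPiltant2019`**: every integral separated
finite-type `X` of dimension `≤ 3` over a field of characteristic `p` has a proper birational
integral separably exceptional model — a resolution (`hasResolution_of_dim_le_three`), whose every
point is regular (first disjunct of `SepExc`). [cite: CossartPiltant2019, Thm. 1.1] -/
theorem sepExcModels_dimLE_three (h : CossartPiltant2019.{0}) {p : ℕ} (k : Type) [Field k]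
    [CharP k p] (X : Scheme.{0}) [IsIntegral X] (f : X ⟶ Spec (.of k)) [IsSeparated f]
    [LocallyOfFiniteType f] [QuasiCompact f] (hd : topologicalKrullDim X ≤ 3) :
    ∃ (X' : Scheme.{0}) (_ : IsIntegral X') (π : X' ⟶ X),
      IsProper π ∧ IsBirational π ∧ SharpStrata.SepExc X' := by
  obtain ⟨X', π, hπ⟩ := hasResolution_of_dim_le_three h (p := p) k X f hd
  haveI : IsReduced X' := hπ.isRegular.isReduced
  exact ⟨X', hπ.isBirational.isIntegral, π, hπ.isProper, hπ.isBirational,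
    fun ζ => Or.inl (hπ.isRegular ζ)⟩

/-- **The crux `SepExcModels` is its dimension-`≥ 4` slice** (registered tool stub T9 of line
`birth`; modulo `CossartPiltant2019`): `SepExcModels ↔` "for every prime `p`, every perfect field
`k` of characteristic `p` and every integral separated finite-type `X/k` with `¬ dim X ≤ 3`, `X` has
a proper birational integral separably exceptional model". The settled dimensions give no
leverage: a proof must begin with fourfolds; a refutation needs a variety of dimension `≥ 4`.
[cite: CossartPiltant2019, Thm. 1.1] -/
theorem stub_sepExcModels_iff_dimGe4 (h : CossartPiltant2019.{0}) :
    SharpStrata.SepExcModels ↔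
      ∀ p : ℕ, p.Prime → ∀ (k : Type) [Field k] [CharP k p] [PerfectField k] (X : Scheme.{0})
        [IsIntegral X] (f : X ⟶ Spec (.of k)), IsSeparated f → LocallyOfFiniteType f →
        QuasiCompact f → ¬ topologicalKrullDim X ≤ 3 →
        ∃ (X' : Scheme.{0}) (_ : IsIntegral X') (π : X' ⟶ X),
          IsProper π ∧ IsBirational π ∧ SharpStrata.SepExc X' := by
  refine ⟨fun H p hp k _ _ _ X _ f hs hl hq _ => H p hp k X f hs hl hq,
    fun H p hp k _ _ _ X _ f hs hl hq => ?_⟩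
  by_cases hd : topologicalKrullDim X ≤ 3
  · haveI := hs; haveI := hl; haveI := hq
    exact sepExcModels_dimLE_three h (p := p) k X f hd
  · exact H p hp k X f hs hl hq hd

/-- **The dimension-`≤ 4` slice of the crux from stmt-18022** (`IsolatedCore.FiniteSingularModelsDimFour`:
every reduced separated finite-type scheme of dimension `≤ 4` over a field of characteristic `p` has
a proper birational reduced model with finitely many non-regular points): that model is integral and
each of its points is regular or closed (`regular_or_isClosed_of_finite_nonRegular`), hence separably
exceptional. Perfectness of `k` idle. [folklore] -/
theorem sepExcModels_dimLE_four_of_finiteSingularModelsDimFour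
    (hW : IsolatedCore.FiniteSingularModelsDimFour) {p : ℕ} (hp : p.Prime) (k : Type) [Field k]
    [CharP k p] (X : Scheme.{0}) [IsIntegral X] (f : X ⟶ Spec (.of k)) [IsSeparated f]
    [LocallyOfFiniteType f] [QuasiCompact f] (hd : topologicalKrullDim X ≤ 4) :
    ∃ (X' : Scheme.{0}) (_ : IsIntegral X') (π : X' ⟶ X),
      IsProper π ∧ IsBirational π ∧ SharpStrata.SepExc X' := by
  obtain ⟨X', hX', π, hπ, hb, hrc⟩ :=
    SharpStrata.isolatedModels_dimLE_four_of_finiteSingularModelsDimFour hW hp k X f hd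
  exact ⟨X', hX', π, hπ, hb, fun ζ => (hrc ζ).elim Or.inl fun hc => Or.inr (Or.inl hc)⟩

end Summit.ResolutionOfSingularities.ResolutionOfSingularities.Theorems.SepExcModels.Dimension

end
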